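import Mathlib
import Literature.NumberTheory.LFunctions.Zhang2022.Section4GWeight
import HarnessLib

/-!
# Zhang (2022) §4, Lemma 4.4: the `g`-weighted partial summation
# "`Σ_{D⁴<n<P²} ν(n)ψ(n)n^{−s}g(P^{9/5}/n) ≪ 𝓛₁(|X₃(P²,ψ)| + ∫_{D⁴}^{P²}|X₃(x,ψ)|x⁻¹dx)`" — PROVED

Topic `Literature/NumberTheory/LFunctions/Zhang2022` (Landau–Siegel adjudication tree;
verdict-neutral). Y. Zhang, *Discrete mean estimates and the Landau–Siegel zero*,
arXiv:2211.02515v1 (2022) [Zhang2022LandauSiegel] — **an unrefereed manuscript under adjudication**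
— §4, proof of Lemma 4.4, p. 19 (tex L1062–L1066; DAG node `Z22:§4.u028`, first `≪`):

> By (3.5) and partial summation, the second sum on the right side above is
> `= ∫_{D⁴}^{P²} g(P^{9/5}/x) x^{s₀−s} dX₃(x,ψ) ≪ 𝓛₁(|X₃(P²,ψ)| + ∫_{D⁴}^{P²} |X₃(x,ψ)|x⁻¹dx) ≪ 𝓛⁻¹⁸⁰.`

The campaign's statements file types the first `≪` as the node `Section4.GSumBound`
(`Section4Statements.lean`, L1-t3): for every `ψ ∈ Ψ` and `s ∈ Ω₃`,
`|Σ_{D⁴<n<⌈P²⌉} ν(n)ψ(n)n^{−s}g(P^{9/5}/n)| ≤ C𝓛₁(|X₃(P²,ψ)| + ∫_{D⁴}^{P²}|X₃(x,ψ)|x⁻¹dx)`.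
This file PROVES it (`Section4.gSumBound_holds`, constant `C = 2e^{2π} + 1`, unconditional,
theorems only, no new definition, no new named fact), by the general-weight partial summation of
`Section4WeightedAbel` with `f(x) = g(P^{9/5}/x)·x^{s₀−s}`, and concludes `Z22:§4.u028` in full
(`gSumBound180_holds`) and the edge `lemma44_of` (Lemma 4.4 from the six remaining analytic
displays):

* the core bound `|Σ_{D⁴<n≤b} …| ≤ e^{2π}|X₃(b,ψ)| + 2e^{2π}𝓛₁∫_{D⁴}^{b}|X₃(x,ψ)|x⁻¹dx`
  (`D⁴ ≤ b ≤ P²`) is the sibling file `Section4GWeight.lean` (`Section4.norm_gSum_Ioc_le`);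
* the typed sum runs over `D⁴ < n < ⌈P²⌉`: when `P² ∉ ℕ` this is `D⁴ < n ≤ ⌊P²⌋` and the
  partial-summation bound applies verbatim; in the (degenerate) case `P² ∈ ℕ` the omitted last term
  is `ν(P²)ψ(P²)(P²)^{−s}g(P^{−1/5})` with `|X₃(P²−1)| ≤ P²∫_{P²−1}^{P²}|X₃|x⁻¹dx` and
  `g(P^{−1/5})e^{2π}P² ≤ 1`, so the bound persists with constant `+1`.

Nothing about Theorems 1–2 of the source or about Landau–Siegel zeros is stated or implied; the
second `≪` (`GSumBound180`) and the use of the bound in Lemma 4.4's proof are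
`Section4Lemma44Chain.gSumBound180_of` / `ded44_holds`.

## References

* Y. Zhang, arXiv:2211.02515v1 (2022), §4 p. 19 (proof of Lemma 4.4), (4.1)–(4.3) p. 18, (2.6),
  (2.8), (2.10). [cite: Zhang2022LandauSiegel, §4 Lemma 4.4 (proof) p. 19]
-/

noncomputable section

open Complex Real Set MeasureTheory Finset intervalIntegral

namespace Literature.NumberTheory.LFunctions.Zhang2022.Section4

open Skeleton
open Lemma41 (Xsum Xsum_def Xsum_eq_sum_Ioc Xsum_self)
open GaussWeight (gauss gWeight gauss_pos gWeight_pos gWeight_lt_one continuous_gauss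
  integrable_gauss gWeight_le)

/-! ### Bookkeeping for the last term (the degenerate case `P² ∈ ℕ`) -/

/-- `D⁴ + 1 ≤ P²` once `𝓛 ≥ 2` (private twin of `Section4LineOneBounds`' lemma).
[cite: Zhang2022LandauSiegel, §2 (2.6)] -/
private theorem pow_four_add_one_le_bigP_sq' {D : ℕ} (hℓ2 : 2 ≤ ell D) : (D : ℝ) ^ 4 + 1 ≤ bigP D ^ 2 := by
  have hℓ : 0 < ell D := by linarith
  have hD0 : (0 : ℝ) < D := by
    have hD : D ≠ 0 := by
      rintro rfl
      simp [ell] at hℓ2; linarith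
    exact_mod_cast Nat.pos_of_ne_zero hD
  have hD1 : (1 : ℝ) ≤ (D : ℝ) ^ 4 := one_le_pow₀ (by
    have hD : D ≠ 0 := by rintro rfl; simp at hD0
    exact_mod_cast Nat.one_le_iff_ne_zero.mpr hD)
  have hD' : (D : ℝ) ^ 4 = Real.exp (4 * ell D) := by
    rw [ell, show (4 : ℝ) * Real.log D = Real.log ((D : ℝ) ^ 4) by
      rw [Real.log_pow]; norm_num, Real.exp_log (by positivity)]
  have h8 : (2 : ℝ) ^ 8 ≤ ell D ^ 8 := pow_le_pow_left₀ (by norm_num) hℓ2 8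
  have hexp : 4 * ell D + 1 ≤ (2 : ℕ) * ell D ^ 9 := by
    push_cast
    calc 4 * ell D + 1 ≤ 2 * (ell D * ell D ^ 8) := by nlinarith [h8, hℓ.le]
      _ = 2 * ell D ^ 9 := by ring
  have h1 : Real.exp (4 * ell D + 1) ≤ bigP D ^ 2 := by
    rw [bigP, ← Real.exp_nat_mul]
    exact Real.exp_le_exp.mpr hexp
  have h2 : (D : ℝ) ^ 4 + 1 ≤ Real.exp (4 * ell D + 1) := by
    rw [Real.exp_add, ← hD']
    have he : (2 : ℝ) ≤ Real.exp 1 := by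
      have := Real.add_one_le_exp (1 : ℝ); linarith
    nlinarith
  exact h2.trans h1

/-- `g(P^{−1/5})·e^{2π}·P² ≤ 1` once `𝓛 ≥ 2` ("trivial bound for the weight":
`g(y) ≤ ½e^{−𝓛³⁰log²y}` for `y ≤ 1`, (4.3), and `𝓛³⁰(𝓛⁹/5)² = 𝓛⁴⁸/25 ≥ 2𝓛⁹ + 2π`).
[cite: Zhang2022LandauSiegel, §4 (4.3)] -/
theorem gW_tail_mul_le_one {D : ℕ} (hℓ2 : 2 ≤ ell D) :
    gW D (bigP D ^ (9 / 5 : ℝ) / bigP D ^ 2) * Real.exp (2 * Real.pi) * bigP D ^ 2 ≤ 1 := by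
  have hℓ1 : 1 ≤ ell D := le_trans one_le_two hℓ2
  have hℓ : 0 < ell D := lt_of_lt_of_le zero_lt_one hℓ1
  have hP : 0 < bigP D := Real.exp_pos _
  have hP1 : 1 ≤ bigP D := by rw [bigP]; exact Real.one_le_exp (by positivity)
  have hΛ : 0 < ell D ^ 30 := by positivity
  have hy : bigP D ^ (9 / 5 : ℝ) / bigP D ^ 2 = bigP D ^ (-(1 / 5) : ℝ) := by
    rw [← Real.rpow_natCast, ← Real.rpow_sub hP]; norm_num
  have hy0 : 0 < bigP D ^ (-(1 / 5) : ℝ) := Real.rpow_pos_of_pos hP _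
  have hy1 : bigP D ^ (-(1 / 5) : ℝ) ≤ 1 := Real.rpow_le_one_of_one_le_of_nonpos hP1 (by norm_num)
  have hlog : Real.log (bigP D ^ (-(1 / 5) : ℝ)) = -(ell D ^ 9 / 5) := by
    rw [Real.log_rpow hP, bigP, Real.log_exp]; ring
  have hg : gW D (bigP D ^ (9 / 5 : ℝ) / bigP D ^ 2)
      ≤ (1 / 2) * Real.exp (-(ell D ^ 30) * (ell D ^ 9 / 5) ^ 2) := by
    rw [hy, gW]
    have h := gWeight_le hΛ hy0 hy1
    rw [hlog, neg_sq] at h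
    exact h
  have hP2 : bigP D ^ 2 = Real.exp (2 * ell D ^ 9) := by
    rw [bigP, ← Real.exp_nat_mul]; norm_num
  -- the exponent inequality `2π + 2𝓛⁹ ≤ 𝓛⁴⁸/25`
  have h39 : (2 : ℝ) ^ 39 ≤ ell D ^ 39 := pow_le_pow_left₀ (by norm_num) hℓ2 39
  have h9 : (2 : ℝ) ^ 9 ≤ ell D ^ 9 := pow_le_pow_left₀ (by norm_num) hℓ2 9
  have h48 : (2 : ℝ) ^ 39 * ell D ^ 9 ≤ ell D ^ 48 := by
    calc (2 : ℝ) ^ 39 * ell D ^ 9 ≤ ell D ^ 39 * ell D ^ 9 :=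
          mul_le_mul_of_nonneg_right h39 (by positivity)
      _ = ell D ^ 48 := by rw [← pow_add]
  have hexp : 2 * Real.pi + 2 * ell D ^ 9 + (-(ell D ^ 30) * (ell D ^ 9 / 5) ^ 2) ≤ 0 := by
    have e : -(ell D ^ 30) * (ell D ^ 9 / 5) ^ 2 = -(ell D ^ 48 / 25) := by ring
    rw [e]
    nlinarith [h48, h9, Real.pi_lt_four]
  have hg0 : 0 ≤ gW D (bigP D ^ (9 / 5 : ℝ) / bigP D ^ 2) := (gWeight_pos hΛ _).le
  calc gW D (bigP D ^ (9 / 5 : ℝ) / bigP D ^ 2) * Real.exp (2 * Real.pi) * bigP D ^ 2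
      ≤ (1 / 2) * Real.exp (-(ell D ^ 30) * (ell D ^ 9 / 5) ^ 2) * Real.exp (2 * Real.pi)
          * bigP D ^ 2 := by gcongr
    _ = (1 / 2) * Real.exp (2 * Real.pi + 2 * ell D ^ 9 + (-(ell D ^ 30) * (ell D ^ 9 / 5) ^ 2)) := by
        rw [hP2, Real.exp_add, Real.exp_add]; ring
    _ ≤ (1 / 2) * 1 := by
        gcongr
        exact Real.exp_le_one_iff.mpr hexp
    _ ≤ 1 := by norm_num

/-- In the degenerate case `P² = N ∈ ℕ`: `|X₃(N−1,ψ)| ≤ P² ∫_{D⁴}^{P²} |X₃(x,ψ)|x⁻¹dx`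
(`X₃(x) = X₃(N−1)` for `N−1 < x < N`, and `1/x ≥ 1/P²` there). [cite: Zhang2022LandauSiegel, §3 p. 7 (X₃)] -/
theorem norm_X3_pred_le {D : ℕ} [NeZero D] (χ : DirichletCharacter ℂ D) (x : Chr D)
    (hℓ2 : 2 ≤ ell D) {m : ℕ} (hm : (D : ℝ) ^ 4 ≤ m) (hb : ((m : ℝ) + 1) = bigP D ^ 2) :
    ‖X3 χ x m‖ ≤ bigP D ^ 2 * ∫ y in (D : ℝ) ^ 4..bigP D ^ 2, ‖X3 χ x y‖ / y := by
  have hℓ : 0 < ell D := by linarith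
  have hDne : D ≠ 0 := by
    rintro rfl
    simp [ell] at hℓ2; linarith
  have hD0 : (0 : ℝ) < D := by exact_mod_cast Nat.pos_of_ne_zero hDne
  have ha0 : (0 : ℝ) < (D : ℝ) ^ 4 := by positivity
  set b : ℝ := bigP D ^ 2 with hbdef
  have hm0 : (0 : ℝ) < m := lt_of_lt_of_le ha0 hm
  have hmb : (m : ℝ) ≤ b := by rw [← hb]; linarith
  have hab : (D : ℝ) ^ 4 ≤ b := hm.trans hmb
  have hb0 : 0 < b := ha0.trans_le hab
  -- integrability of `|X₃(y)|/y` on `[D⁴, P²]`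
  set c : ℕ → ℂ := fun n => nu χ n * x.ψ (n : ZMod x.p) * (n : ℂ) ^ (-s0 D) with hc
  have hXs : ∀ y : ℝ, Xsum c ((D : ℝ) ^ 4) y = X3 χ x y := fun y => by
    rw [hc]; exact Xsum_eq_X3 χ x y
  have hXint : IntervalIntegrable (fun y : ℝ => ‖X3 χ x y‖ / y) volume ((D : ℝ) ^ 4) b := by
    have h := intervalIntegrable_norm_Xsum_div c ha0 hab
    simp_rw [hXs] at h
    exact h
  have hXint' : IntervalIntegrable (fun y : ℝ => ‖X3 χ x y‖ / y) volume (m : ℝ) b :=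
    hXint.mono_set (by
      rw [Set.uIcc_of_le hmb, Set.uIcc_of_le hab]
      exact Set.Icc_subset_Icc hm le_rfl)
  -- on `(m, b)`: `X₃(y) = X₃(m)` and `1/y > 1/b`
  have hstep : ∀ y ∈ Set.Ioo (m : ℝ) b, ‖X3 χ x m‖ / b ≤ ‖X3 χ x y‖ / y := by
    intro y hy
    have hy0 : 0 < y := hm0.trans hy.1
    have hfl : ⌊y⌋₊ = m := by
      rw [Nat.floor_eq_iff hy0.le]
      exact ⟨hy.1.le, by rw [hb]; exact hy.2⟩
    have hXy : X3 χ x y = X3 χ x m := by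
      simp only [X3, hfl, Nat.floor_natCast]
    rw [hXy]
    exact div_le_div_of_nonneg_left (norm_nonneg _) hy0 hy.2.le
  have hI1 : ∫ y in (m : ℝ)..b, ‖X3 χ x m‖ / b ≤ ∫ y in (m : ℝ)..b, ‖X3 χ x y‖ / y :=
    intervalIntegral.integral_mono_on_of_le_Ioo hmb intervalIntegrable_const hXint' hstep
  have hI0 : ∫ y in (m : ℝ)..b, ‖X3 χ x m‖ / b = ‖X3 χ x m‖ / b := by
    rw [intervalIntegral.integral_const, smul_eq_mul, ← hb]; ring
  have hI2 : ∫ y in (m : ℝ)..b, ‖X3 χ x y‖ / y ≤ ∫ y in (D : ℝ) ^ 4..b, ‖X3 χ x y‖ / y := by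
    refine intervalIntegral.integral_mono_interval hm hmb le_rfl ?_ hXint
    refine MeasureTheory.ae_restrict_of_forall_mem measurableSet_Ioc fun y hy => ?_
    exact div_nonneg (norm_nonneg _) (ha0.trans hy.1).le
  have hfin : ‖X3 χ x m‖ / b ≤ ∫ y in (D : ℝ) ^ 4..b, ‖X3 χ x y‖ / y := by
    rw [← hI0]; exact hI1.trans hI2
  rwa [div_le_iff₀ hb0, mul_comm] at hfin

/-! ### The node `Section4.GSumBound` HOLDS -/

/-- `Σ_{D⁴<n<⌊b⌋+1} = Σ_{D⁴<n≤⌊b⌋}` on `ℕ`. [folklore] -/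
private theorem Ioo_floor_succ_eq_Ioc (a N : ℕ) : Finset.Ioo a (N + 1) = Finset.Ioc a N := by
  ext n
  simp only [Finset.mem_Ioo, Finset.mem_Ioc]
  omega

/-- **`Z22:§4.u028`, first `≪`, HOLDS** [Z22 p. 19, tex L1062–L1066]: the typed node
`Section4.GSumBound` — for every `ψ ∈ Ψ` and `s ∈ Ω₃`,
`|Σ_{D⁴<n<P²} ν(n)ψ(n)n^{−s}g(P^{9/5}/n)| ≤ C𝓛₁(|X₃(P²,ψ)| + ∫_{D⁴}^{P²}|X₃(x,ψ)|x⁻¹dx)` — with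
`C = 2e^{2π} + 1`, for `D ≥ ⌈e²⌉` ("by … partial summation": `Section4.norm_sum_mul_weight_le` with
the weight `g(P^{9/5}/x)x^{s₀−s}`; the typed range `n < ⌈P²⌉` is `n ≤ ⌊P²⌋` unless `P² ∈ ℕ`, in which
case the omitted last term is at most the bracket, `g(P^{−1/5})e^{2π}P² ≤ 1`). Kernel-checked,
unconditional. [cite: Zhang2022LandauSiegel, §4 Lemma 4.4 (proof) p. 19] -/
theorem gSumBound_holds : GSumBound := by
  refine ⟨2 * Real.exp (2 * Real.pi) + 1, ⌈Real.exp 2⌉₊, fun D _ χ hD hq hp x s hs => ?_⟩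
  have hℓ2 : 2 ≤ ell D := le_ell_of_ceil_exp_le hD
  have hℓ1 : 1 ≤ ell D := le_trans one_le_two hℓ2
  have hℓ : 0 < ell D := lt_of_lt_of_le zero_lt_one hℓ1
  have hDne : D ≠ 0 := by
    rintro rfl
    simp [ell] at hℓ2; linarith
  have hD0 : (0 : ℝ) < D := by exact_mod_cast Nat.pos_of_ne_zero hDne
  have hP : 0 < bigP D := Real.exp_pos _
  have hΛ : 0 < ell D ^ 30 := by positivity
  have ha0 : (0 : ℝ) < (D : ℝ) ^ 4 := by positivity
  set b : ℝ := bigP D ^ 2 with hbdef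
  have hab : (D : ℝ) ^ 4 ≤ b := pow_four_le_bigP_sq hℓ2
  have hab1 : (D : ℝ) ^ 4 + 1 ≤ b := pow_four_add_one_le_bigP_sq' hℓ2
  have hb0 : 0 < b := ha0.trans_le hab
  have hD1 : (1 : ℝ) ≤ D := by exact_mod_cast Nat.one_le_iff_ne_zero.mpr hDne
  have hD41 : (1 : ℝ) ≤ (D : ℝ) ^ 4 := one_le_pow₀ hD1
  have hb1 : 1 ≤ b := by linarith
  set B : ℝ := ‖X3 χ x b‖ + ∫ y in (D : ℝ) ^ 4..b, ‖X3 χ x y‖ / y with hB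
  have hint : 0 ≤ ∫ y in (D : ℝ) ^ 4..b, ‖X3 χ x y‖ / y := by
    refine intervalIntegral.integral_nonneg hab fun y hy => ?_
    exact div_nonneg (norm_nonneg _) (le_trans (by positivity) hy.1)
  have hB0 : 0 ≤ B := add_nonneg (norm_nonneg _) hint
  have hℓ1' : 1 ≤ ell1 D := by rw [ell1]; exact one_le_pow₀ hℓ1
  have he : 0 < Real.exp (2 * Real.pi) := Real.exp_pos _
  -- the partial-summation bound on `D⁴ < n ≤ ⌊P²⌋`
  have hIoc := norm_gSum_Ioc_le χ x hℓ2 hs hab le_rfl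
  have hIoc' : Real.exp (2 * Real.pi) * ‖X3 χ x b‖
      + 2 * Real.exp (2 * Real.pi) * ell1 D * ∫ y in (D : ℝ) ^ 4..b, ‖X3 χ x y‖ / y
      ≤ 2 * Real.exp (2 * Real.pi) * ell1 D * B := by
    have h0 : Real.exp (2 * Real.pi) ≤ 2 * Real.exp (2 * Real.pi) * ell1 D := by nlinarith
    have h1 : Real.exp (2 * Real.pi) * ‖X3 χ x b‖ ≤ 2 * Real.exp (2 * Real.pi) * ell1 D * ‖X3 χ x b‖ :=
      mul_le_mul_of_nonneg_right h0 (norm_nonneg _)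
    calc Real.exp (2 * Real.pi) * ‖X3 χ x b‖
          + 2 * Real.exp (2 * Real.pi) * ell1 D * ∫ y in (D : ℝ) ^ 4..b, ‖X3 χ x y‖ / y
        ≤ 2 * Real.exp (2 * Real.pi) * ell1 D * ‖X3 χ x b‖
          + 2 * Real.exp (2 * Real.pi) * ell1 D * ∫ y in (D : ℝ) ^ 4..b, ‖X3 χ x y‖ / y :=
          by linarith [h1]
      _ = 2 * Real.exp (2 * Real.pi) * ell1 D * B := by rw [hB]; ring
  unfold gSum
  -- `⌈P²⌉ = ⌊P²⌋ + 1` (generic) or `⌈P²⌉ = ⌊P²⌋` (`P² ∈ ℕ`)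
  have hfc : ⌈b⌉₊ = ⌊b⌋₊ + 1 ∨ ⌈b⌉₊ = ⌊b⌋₊ := by
    have h1 : ⌊b⌋₊ ≤ ⌈b⌉₊ := Nat.floor_le_ceil b
    have h2 : ⌈b⌉₊ ≤ ⌊b⌋₊ + 1 := Nat.ceil_le_floor_add_one b
    omega
  rcases hfc with hA | hBcase
  · -- generic case
    rw [hA, Ioo_floor_succ_eq_Ioc]
    calc _ ≤ Real.exp (2 * Real.pi) * ‖X3 χ x b‖
          + 2 * Real.exp (2 * Real.pi) * ell1 D * ∫ y in (D : ℝ) ^ 4..b, ‖X3 χ x y‖ / y := hIoc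
      _ ≤ 2 * Real.exp (2 * Real.pi) * ell1 D * B := hIoc'
      _ ≤ (2 * Real.exp (2 * Real.pi) + 1) * ell1 D * B := by
          gcongr; linarith
  · -- degenerate case `P² ∈ ℕ`: `b = ⌊b⌋`
    set N : ℕ := ⌊b⌋₊ with hN
    have hbN : (N : ℝ) = b := le_antisymm (Nat.floor_le hb0.le) (by
      have := Nat.le_ceil b; rw [hBcase] at this; exact this)
    have hN1 : D ^ 4 + 1 ≤ N := by
      have : ((D ^ 4 + 1 : ℕ) : ℝ) ≤ (N : ℝ) := by rw [hbN]; push_cast; exact hab1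
      exact_mod_cast this
    obtain ⟨m, hm⟩ : ∃ m, N = m + 1 := ⟨N - 1, by omega⟩
    have hm4 : D ^ 4 ≤ m := by omega
    have hmR : (D : ℝ) ^ 4 ≤ (m : ℝ) := by exact_mod_cast hm4
    have hmb : (m : ℝ) + 1 = b := by
      rw [← hbN, hm]; push_cast; ring
    rw [hBcase]
    -- `Σ_{D⁴<n<N} = Σ_{D⁴<n≤N} − (term at N)`, `N = m + 1`
    have hsplit : ∑ n ∈ Finset.Ioc (D ^ 4) N, nu χ n * x.ψ (n : ZMod x.p) * (n : ℂ) ^ (-s)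
          * (gW D (bigP D ^ (9 / 5 : ℝ) / (n : ℝ)) : ℂ)
        = (∑ n ∈ Finset.Ioo (D ^ 4) N, nu χ n * x.ψ (n : ZMod x.p) * (n : ℂ) ^ (-s)
            * (gW D (bigP D ^ (9 / 5 : ℝ) / (n : ℝ)) : ℂ))
          + nu χ N * x.ψ (N : ZMod x.p) * (N : ℂ) ^ (-s)
            * (gW D (bigP D ^ (9 / 5 : ℝ) / (N : ℝ)) : ℂ) := by
      rw [← Finset.Ioo_insert_right (by omega : D ^ 4 < N), Finset.sum_insert Finset.right_notMem_Ioo,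
        add_comm]
    have hIooEq : ∑ n ∈ Finset.Ioo (D ^ 4) N, nu χ n * x.ψ (n : ZMod x.p) * (n : ℂ) ^ (-s)
          * (gW D (bigP D ^ (9 / 5 : ℝ) / (n : ℝ)) : ℂ)
        = (∑ n ∈ Finset.Ioc (D ^ 4) N, nu χ n * x.ψ (n : ZMod x.p) * (n : ℂ) ^ (-s)
            * (gW D (bigP D ^ (9 / 5 : ℝ) / (n : ℝ)) : ℂ))
          - nu χ N * x.ψ (N : ZMod x.p) * (N : ℂ) ^ (-s)
            * (gW D (bigP D ^ (9 / 5 : ℝ) / (N : ℝ)) : ℂ) := by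
      rw [hsplit]; ring
    -- the last term: coefficient `c(N) = X₃(N) − X₃(m)`, weight `g(P^{−1/5})N^{1/2−σ}`
    obtain ⟨hσ1, hσ2, ht⟩ := hs
    have hα : alpha D = Real.pi / ell D ^ 9 := by rw [alpha, bigP, Real.log_exp]
    have hNpos : (0 : ℝ) < N := by rw [hbN]; exact hb0
    have hN0 : (N : ℂ) ≠ 0 := by exact_mod_cast (show (N : ℝ) ≠ 0 from hNpos.ne')
    have hcN : nu χ N * x.ψ (N : ZMod x.p) * (N : ℂ) ^ (-s0 D) = X3 χ x N - X3 χ x m := by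
      simp only [X3, Nat.floor_natCast]
      rw [hm, Finset.sum_Ioc_succ_top hm4]
      push_cast
      ring
    have hterm : nu χ N * x.ψ (N : ZMod x.p) * (N : ℂ) ^ (-s)
          * (gW D (bigP D ^ (9 / 5 : ℝ) / (N : ℝ)) : ℂ)
        = (X3 χ x N - X3 χ x m) * ((N : ℂ) ^ (s0 D - s)
          * (gW D (bigP D ^ (9 / 5 : ℝ) / (N : ℝ)) : ℂ)) := by
      rw [← hcN]
      have e : (N : ℂ) ^ (-s) = (N : ℂ) ^ (-s0 D) * (N : ℂ) ^ (s0 D - s) := by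
        rw [← Complex.cpow_add _ _ hN0]; congr 1; ring
      rw [e]; ring
    -- `N^{Re(s₀−s)} ≤ e^{2π}`
    have hNre : ‖(N : ℂ) ^ (s0 D - s)‖ ≤ Real.exp (2 * Real.pi) := by
      rw [show (N : ℂ) = ((N : ℝ) : ℂ) by norm_cast, Complex.norm_cpow_eq_rpow_re_of_pos hNpos]
      have hre : (s0 D - s).re = 1 / 2 - s.re := by rw [s0, SmoothWeight.s0_def]; simp
      rw [hre, hbN]
      rcases le_or_gt (1 / 2 - s.re) 0 with hle | hgt
      · exact le_trans (Real.rpow_le_one_of_one_le_of_nonpos hb1 hle) (Real.one_le_exp (by positivity))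
      · have hP1 : 1 ≤ bigP D := by rw [bigP]; exact Real.one_le_exp (by positivity)
        calc b ^ (1 / 2 - s.re) ≤ b ^ (alpha D) :=
              Real.rpow_le_rpow_of_exponent_le (by rw [hbdef]; exact one_le_pow₀ hP1) (by linarith)
          _ = Real.exp (2 * Real.pi) := by
              rw [hbdef, bigP, ← Real.exp_nat_mul, ← Real.exp_mul, hα]
              congr 1; field_simp; norm_num
    have hg0 : 0 ≤ gW D (bigP D ^ (9 / 5 : ℝ) / (N : ℝ)) := (gWeight_pos hΛ _).le
    have hgtail : gW D (bigP D ^ (9 / 5 : ℝ) / (N : ℝ)) * Real.exp (2 * Real.pi) * b ≤ 1 := by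
      rw [hbN, hbdef]; exact gW_tail_mul_le_one hℓ2
    have hX3m : ‖X3 χ x m‖ ≤ b * ∫ y in (D : ℝ) ^ 4..b, ‖X3 χ x y‖ / y :=
      norm_X3_pred_le χ x hℓ2 hmR hmb
    have hX3N : X3 χ x N = X3 χ x b := by simp only [X3, Nat.floor_natCast, hN]
    have hlast : ‖nu χ N * x.ψ (N : ZMod x.p) * (N : ℂ) ^ (-s)
          * (gW D (bigP D ^ (9 / 5 : ℝ) / (N : ℝ)) : ℂ)‖ ≤ B := by
      rw [hterm, norm_mul, norm_mul, Complex.norm_real, Real.norm_eq_abs, abs_of_nonneg hg0, hX3N]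
      have h1 : ‖X3 χ x b - X3 χ x m‖ ≤ ‖X3 χ x b‖ + b * ∫ y in (D : ℝ) ^ 4..b, ‖X3 χ x y‖ / y :=
        (norm_sub_le _ _).trans (add_le_add le_rfl hX3m)
      have h2 : ‖X3 χ x b‖ + b * ∫ y in (D : ℝ) ^ 4..b, ‖X3 χ x y‖ / y ≤ b * B := by
        rw [hB, mul_add]
        gcongr
        exact le_mul_of_one_le_left (norm_nonneg _) hb1
      calc ‖X3 χ x b - X3 χ x m‖ * (‖(N : ℂ) ^ (s0 D - s)‖ * gW D (bigP D ^ (9 / 5 : ℝ) / (N : ℝ)))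
          ≤ (b * B) * (Real.exp (2 * Real.pi) * gW D (bigP D ^ (9 / 5 : ℝ) / (N : ℝ))) :=
            mul_le_mul (h1.trans h2) (mul_le_mul_of_nonneg_right hNre hg0)
              (mul_nonneg (norm_nonneg _) hg0) (mul_nonneg hb0.le hB0)
        _ = (gW D (bigP D ^ (9 / 5 : ℝ) / (N : ℝ)) * Real.exp (2 * Real.pi) * b) * B := by ring
        _ ≤ 1 * B := mul_le_mul_of_nonneg_right hgtail hB0
        _ = B := one_mul B
    -- the `Ioc` part, with `⌊b⌋ = N`
    have hIocN : ‖∑ n ∈ Finset.Ioc (D ^ 4) N, nu χ n * x.ψ (n : ZMod x.p) * (n : ℂ) ^ (-s)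
          * (gW D (bigP D ^ (9 / 5 : ℝ) / (n : ℝ)) : ℂ)‖ ≤ 2 * Real.exp (2 * Real.pi) * ell1 D * B :=
      hIoc.trans hIoc'
    rw [hIooEq]
    calc _ ≤ ‖∑ n ∈ Finset.Ioc (D ^ 4) N, nu χ n * x.ψ (n : ZMod x.p) * (n : ℂ) ^ (-s)
            * (gW D (bigP D ^ (9 / 5 : ℝ) / (n : ℝ)) : ℂ)‖
          + ‖nu χ N * x.ψ (N : ZMod x.p) * (N : ℂ) ^ (-s)
            * (gW D (bigP D ^ (9 / 5 : ℝ) / (N : ℝ)) : ℂ)‖ := norm_sub_le _ _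
      _ ≤ 2 * Real.exp (2 * Real.pi) * ell1 D * B + B := add_le_add hIocN hlast
      _ ≤ 2 * Real.exp (2 * Real.pi) * ell1 D * B + ell1 D * B := by
          gcongr; exact le_mul_of_one_le_left hB0 hℓ1'
      _ = (2 * Real.exp (2 * Real.pi) + 1) * ell1 D * B := by ring

/-- **`Z22:§4.u028` HOLDS in full**: the typed node `Section4.GSumBound180` — for `ψ ∈ Ψ₁` and
`s ∈ Ω₃`, `Σ_{D⁴<n<P²} ν(n)ψ(n)n^{−s}g(P^{9/5}/n) ≪ 𝓛⁻¹⁸⁰` — by `gSumBound_holds` and (3.5)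
(`Section4Lemma44Chain.gSumBound180_of`). Kernel-checked, unconditional (for `ψ ∈ Ψ₁` the
inequality (3.5) is part of the DEFINITION of `Ψ₁`). [cite: Zhang2022LandauSiegel, §4 Lemma 4.4 (proof) p. 19] -/
theorem gSumBound180_holds : GSumBound180 := gSumBound180_of gSumBound_holds

/-- With `Z22:§4.u028` discharged, the manuscript's proof of Lemma 4.4 (`Z22:Lem4.4.pf`,
`Section4Lemma44Chain.ded44_holds`) reduces `Skeleton.Lemma44` to the six remaining analytic displays:
the residue split, the evaluation of the line `Re w = 1`, the three-way split, and (4.7), (4.8),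
(4.9). Kernel-checked edge. [cite: Zhang2022LandauSiegel, §4 Lemma 4.4 (proof) pp. 19–20] -/
theorem lemma44_of (hRS : ResidueSplit) (hL1 : LineOneEval) (hTW : ThreeWaySplit) (h47 : Eq47)
    (h48 : Eq48) (h49 : Eq49) : Lemma44 :=
  ded44_holds hRS hL1 gSumBound180_holds hTW h47 h48 h49

end Literature.NumberTheory.LFunctions.Zhang2022.Section4

end
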